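import Summits.Ventures.AbcSig.Levels.N6112P1
import Summits.Ventures.AbcSig.Levels.N6112T2
import Summits.Ventures.AbcSig.Levels.N6112T3

/-!
# Venture AbcSig — GENERATED level file, level 6112 (AGGREGATOR of 3 part files)

HONEST FRAMING. As in the part files `N6112P<i>.lean` (same generator run, same certified level file
`N6112.engine1.json`, sha256 `4958b27d63a27bea5efbc12ac9f1c0838d7b70789a426b0fa8731dd042beb3b2`): this file only concatenates the orbit lists and the part summaries into
`level6112Orbits`, `level6112_wellformed`, `level6112_sieve` (the shapes the row templates consume). The split exists because the
tree's files are ≤ 400 lines. Union of residual exponents ≥ 7: [7, 13]; orbits not eliminable by the sieve: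
none. No Diophantine statement is made here; no claim on ABC or any summit.
-/

namespace Summit.Ventures.AbcSig

/-- All newform orbits of level 6112 (concatenation of the parts, engine order). -/
def level6112Orbits : List OrbitData :=
  level6112OrbitsP1 ++ level6112OrbitsT2 ++ level6112OrbitsT3

/-- Every listed entry is at an odd prime not dividing 6112. -/
theorem level6112_wellformed :
    ∀ o ∈ level6112Orbits, ∀ e ∈ o.coeffs, e.ell.Prime ∧ e.ell ≠ 2 ∧ ¬ e.ell ∣ 6112 := by
  unfold level6112Orbits
  exact List.forall_mem_append.2 ⟨List.forall_mem_append.2 ⟨level6112_wellformedP1, level6112_wellformedT2⟩, level6112_wellformedT3⟩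

/-- **Level 6112 summary.** For a prime exponent `n ≥ 7`, every orbit of level 6112 is sieve-eliminated by the
kernel certificates of the part files, except that the row's predicate `X` is assumed for: orbit_6112_1 if n ∈ [7], orbit_6112_2 if n ∈ [7], orbit_6112_3 if n ∈ [7], orbit_6112_4 if n ∈ [7], orbit_6112_5 if n ∈ [13], orbit_6112_8 if n ∈ [13], orbit_6112_9 if n ∈ [7], orbit_6112_10 if n ∈ [7]. -/
theorem level6112_sieve (n : ℕ) (hn : n.Prime) (hmin : 7 ≤ n) (X : OrbitData → Prop)
    (h_orbit_6112_1 : n ∈ ([7] : List ℕ) → X orbit_6112_1)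
    (h_orbit_6112_2 : n ∈ ([7] : List ℕ) → X orbit_6112_2)
    (h_orbit_6112_3 : n ∈ ([7] : List ℕ) → X orbit_6112_3)
    (h_orbit_6112_4 : n ∈ ([7] : List ℕ) → X orbit_6112_4)
    (h_orbit_6112_5 : n ∈ ([13] : List ℕ) → X orbit_6112_5)
    (h_orbit_6112_8 : n ∈ ([13] : List ℕ) → X orbit_6112_8)
    (h_orbit_6112_9 : n ∈ ([7] : List ℕ) → X orbit_6112_9)
    (h_orbit_6112_10 : n ∈ ([7] : List ℕ) → X orbit_6112_10) :
    ∀ o ∈ level6112Orbits, (∀ e ∈ o.coeffs, e.ell.Prime ∧ e.ell ≠ 2 ∧ ¬ e.ell ∣ 6112) ∧ (o.Eliminated bs04Allowed n ∨ X o) := by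
  unfold level6112Orbits
  exact List.forall_mem_append.2 ⟨List.forall_mem_append.2 ⟨(level6112_sieveP1 n hn hmin X h_orbit_6112_1 h_orbit_6112_2 h_orbit_6112_3 h_orbit_6112_4 h_orbit_6112_5), (level6112_sieveT2 n hn hmin X h_orbit_6112_8)⟩, (level6112_sieveT3 n hn hmin X h_orbit_6112_9 h_orbit_6112_10)⟩

end Summit.Ventures.AbcSig
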